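import Mathlib
import Summits.AtomisticToContinuum.FouriersLaw.Theses.FeketeSeriesLaw
import Summits.AtomisticToContinuum.FouriersLaw.Theorems.OddSectorIrreversibilityBoundedResponseConvergesEscapeDeficitForm
import Summits.AtomisticToContinuum.FouriersLaw.Theorems.OddSectorIrreversibilityBoundedResponseConvergesOfSeriesLaw
import Summits.AtomisticToContinuum.FouriersLaw.Theorems.BondHeatUncertaintyPositiveOrInfiniteLimitSplit

/-!
# Stubs `quasiSubadditiveResistance_of_escapeResistanceQuasiSubadditive` and
# `boundedResponseConverges_of_escapeResistanceQuasiSubadditive` of line `escape-deficit-dichotomy`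
# (crux stmt-AtomisticToContinuum-9141, `OddSectorIrreversibility.BoundedResponseConverges`)

**The escape-resistance series law alone closes the crux.** For the pinned anharmonic chain
`pinnedChain ω₂ lam β γ` (all four parameters `> 0`) and a temperature `T > 0` write
`E_N = 1 - (γ/T²) ∫_{(0,∞)} K_N(u) du`, `K_N(u) = ∫ (p₀² - T) · P_u(p₀² - T) dμ_T` (Gibbs measure
`gibbsMeasure N T`, equal-temperature kernels `transitionKernel N T T u⁺`; kernel `0` for `N = 0`) for the
escape deficit, and `1/(γ E_N)` for the ESCAPE RESISTANCE. The E-form series law (= the hardest stub of the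
birth skeleton of item `EscapeNonOscillation`, stmt-AtomisticToContinuum-12238, verbatim up to qualification)
asks for a constant `C` with `1/(γE_{n+m}) ≤ 1/(γE_n) + 1/(γE_m) + C` for all `n, m ≥ 2`.

* `quasiSubadditiveResistance_of_escapeResistanceQuasiSubadditive` — the E-form series law implies
  `FeketeSeriesLaw.QuasiSubadditiveResistance` (stmt-AtomisticToContinuum-14041) verbatim: under weak-NESS
  uniqueness, along ANY steady-state family the clause-(ii) response coefficient at length `N ≥ 1` IS
  `D_N = (N-1)·γ·E_N` (`responseCoeff_eq_escapeDeficit`, landed), so the bath-to-bath resistance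
  `R_N = (N-1)/D_N` equals `1/(γE_N)` for `N ≥ 2` (in Lean's `x/0 = 0` convention the degenerate value
  `E_N = 0` gives `0 = 0`, so no positivity input is needed), and the series law transports term by term.
* `boundedResponseConverges_of_escapeResistanceQuasiSubadditive` — hence the E-form series law closes the
  crux `OddSectorIrreversibility.BoundedResponseConverges` by name, through the landed reduction
  `Stubs.boundedResponseConverges_of_quasiSubadditiveResistance` (Fekete with additive defect + positive
  conductance + the crux's own boundedness).
* `positiveOrInfiniteLimit_of_escapeResistanceQuasiSubadditive`,
  `conductanceLowerBound_of_escapeResistanceQuasiSubadditive` — the same hypothesis fills the shared import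
  slot `BondHeatUncertainty.PositiveOrInfiniteLimit` (stmt-AtomisticToContinuum-9128) and hence the Ohmic
  floor `JunctionLocality.ConductanceLowerBound` (stmt-AtomisticToContinuum-11749), by the landed
  `Stubs.positiveOrInfiniteLimit_of_quasiSubadditiveResistance` and
  `PositiveOrInfiniteLimit.conductanceLowerBound_of_positiveOrInfiniteLimit`.

Pure glue over landed theorems: no definitions, no named-fact hypotheses (the E-form antecedent is part of
the registered signatures); standard axioms. References: Kundu–Dhar–Narayan 2009 (Green–Kubo form of the
boundary response, arXiv:0809.4543 p. 3); Hammersley 1988 §1 (subadditivity with defect).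
-/

noncomputable section

open MeasureTheory Filter Topology Set

namespace Summit.AtomisticToContinuum.FouriersLaw.Theorems.EscapeDeficitDichotomy

open Literature.MathematicalPhysics.KineticTheory.HeatConduction
open Summit.AtomisticToContinuum.FouriersLaw.Theses

/-- **Resistance = escape resistance.** Under weak-NESS uniqueness, along any steady-state family of
`pinnedChain ω₂ lam β γ` (all `> 0`), at `T > 0`: if `D K` is the clause-(ii) response coefficient at a
length `K ≥ 2`, then `(K-1)/D K = 1/(γ·E_K)` with `E_K = 1 - (γ/T²)∫_{u>0} K_K(u)` the escape deficit
(both sides are `0` when `E_K = 0`, by `x/0 = 0`). From `D K = (K-1)·γ·E_K` (`responseCoeff_eq_escapeDeficit`).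
[cite: KunduDharNarayan2009, arXiv:0809.4543 p. 3] -/
theorem resistance_eq_inv_escape {ω₂ lam β γ : ℝ} (hω : 0 < ω₂) (hl : 0 < lam) (hβ : 0 < β)
    (hγ : 0 < γ)
    (hU : ∀ (N : ℕ) (T_L T_R : ℝ), 0 < T_L → 0 < T_R → ∀ μ ν : Measure (PhaseSpace N),
      (pinnedChain ω₂ lam β γ).IsSteadyState N T_L T_R μ →
        (pinnedChain ω₂ lam β γ).IsSteadyState N T_L T_R ν → μ = ν)
    (μ : (N : ℕ) → ℝ → ℝ → Measure (PhaseSpace N))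
    (hμ : ∀ (N : ℕ) (T_L T_R : ℝ), 0 < T_L → 0 < T_R →
      (pinnedChain ω₂ lam β γ).IsSteadyState N T_L T_R (μ N T_L T_R))
    {T : ℝ} (hT : 0 < T) {K : ℕ} (hK : 2 ≤ K) {d : ℝ}
    (hd : Tendsto (fun δ : ℝ =>
        (pinnedChain ω₂ lam β γ).totalCurrent (μ K (T + δ / 2) (T - δ / 2)) / δ) (𝓝[≠] 0) (𝓝 d)) :
    ((K - 1 : ℕ) : ℝ) / d = 1 / (γ * (1 - γ / T ^ 2 * ∫ u in Set.Ioi (0 : ℝ),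
      (if h : 0 < K then ∫ z, ((z.2 ⟨0, h⟩) ^ 2 - T) * (∫ y, ((y.2 ⟨0, h⟩) ^ 2 - T)
        ∂((pinnedChain ω₂ lam β γ).transitionKernel K T T u.toNNReal z))
        ∂((pinnedChain ω₂ lam β γ).gibbsMeasure K T) else 0))) := by
  have hK0 : 0 < K := lt_of_lt_of_le Nat.zero_lt_two hK
  rw [responseCoeff_eq_escapeDeficit hω hl hβ hγ hU μ hμ hT hK0 hd]
  simp only [dif_pos hK0]
  have hK1 : ((K : ℝ) - 1) ≠ 0 := by
    have h2 : (2 : ℝ) ≤ (K : ℝ) := by exact_mod_cast hK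
    exact ne_of_gt (by linarith)
  rw [Nat.cast_sub (le_trans one_le_two hK), Nat.cast_one, mul_assoc, div_mul_cancel_left₀ hK1, one_div]

/-- **Stub `quasiSubadditiveResistance_of_escapeResistanceQuasiSubadditive`, PROVED — the E-form series
law IS the series law `FeketeSeriesLaw.QuasiSubadditiveResistance` (stmt-AtomisticToContinuum-14041).**
If for all parameters `> 0` and `T > 0` the escape resistances `1/(γE_N)` (`E` the escape-deficit
sequence, `E N = 1 - (γ/T²)∫_{u>0} K_N(u)`, verbatim the route's `let E`) satisfy
`1/(γE_{n+m}) ≤ 1/(γE_n) + 1/(γE_m) + C` for `n, m ≥ 2`, then under weak-NESS uniqueness, along every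
steady-state family and for all response coefficients `D`, `(N+M-1)/D_{N+M} ≤ (N-1)/D_N + (M-1)/D_M + C`
for `N, M ≥ 2`: every resistance `(K-1)/D_K`, `K ≥ 2`, equals `1/(γE_K)` (`resistance_eq_inv_escape`).
[cite: KunduDharNarayan2009, arXiv:0809.4543 p. 3] -/
theorem quasiSubadditiveResistance_of_escapeResistanceQuasiSubadditive : (∀ ω₂ lam β γ : ℝ, 0 < ω₂ → 0 < lam → 0 < β → 0 < γ → ∀ T : ℝ, 0 < T → ∀ E : ℕ → ℝ, (∀ N : ℕ, E N = 1 - γ / T ^ 2 * ∫ u in Set.Ioi (0 : ℝ), (if h : 0 < N then ∫ z, ((z.2 ⟨0, h⟩) ^ 2 - T) * (∫ y, ((y.2 ⟨0, h⟩) ^ 2 - T) ∂((Literature.MathematicalPhysics.KineticTheory.HeatConduction.pinnedChain ω₂ lam β γ).transitionKernel N T T u.toNNReal z)) ∂((Literature.MathematicalPhysics.KineticTheory.HeatConduction.pinnedChain ω₂ lam β γ).gibbsMeasure N T) else 0)) → ∃ C : ℝ, ∀ n m : ℕ, 2 ≤ n → 2 ≤ m → 1 / (γ * E (n + m)) ≤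 1 / (γ * E n) + 1 / (γ * E m) + C) → Summit.AtomisticToContinuum.FouriersLaw.Theses.FeketeSeriesLaw.QuasiSubadditiveResistance := by
  intro hQ ω₂ lam β γ hω hl hβ hγ hU μ hμ T hT D hD
  -- the escape-deficit sequence at this parameter point and temperature
  set E : ℕ → ℝ := fun N => 1 - γ / T ^ 2 * ∫ u in Set.Ioi (0 : ℝ),
    (if h : 0 < N then ∫ z, ((z.2 ⟨0, h⟩) ^ 2 - T) * (∫ y, ((y.2 ⟨0, h⟩) ^ 2 - T)
      ∂((pinnedChain ω₂ lam β γ).transitionKernel N T T u.toNNReal z))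
      ∂((pinnedChain ω₂ lam β γ).gibbsMeasure N T) else 0) with hEdef
  obtain ⟨C, hC⟩ := hQ ω₂ lam β γ hω hl hβ hγ T hT E (fun N => by simp only [hEdef])
  -- every resistance `(K-1)/D K`, `K ≥ 2`, is the escape resistance `1/(γ E K)`
  have key : ∀ K : ℕ, 2 ≤ K → ((K - 1 : ℕ) : ℝ) / D K = 1 / (γ * E K) := by
    intro K hK
    rw [resistance_eq_inv_escape hω hl hβ hγ hU μ hμ hT hK (hD K)]
  refine ⟨C, fun N M hN hM => ?_⟩
  rw [key (N + M) (le_trans hN (Nat.le_add_right N M)), key N hN, key M hM]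
  exact hC N M hN hM

/-- **Stub `boundedResponseConverges_of_escapeResistanceQuasiSubadditive`, PROVED — the E-form series law
ALONE closes the crux `OddSectorIrreversibility.BoundedResponseConverges` (stmt-AtomisticToContinuum-9141).**
The hypothesis gives `FeketeSeriesLaw.QuasiSubadditiveResistance`
(`quasiSubadditiveResistance_of_escapeResistanceQuasiSubadditive`), and the landed reduction
`Stubs.boundedResponseConverges_of_quasiSubadditiveResistance` (Fekete's lemma with additive defect,
positive conductance at every finite length, and the crux's own `BddAbove (range |D|)`) turns it into a real
positive limit of the response coefficients. [folklore] -/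
theorem boundedResponseConverges_of_escapeResistanceQuasiSubadditive : (∀ ω₂ lam β γ : ℝ, 0 < ω₂ → 0 < lam → 0 < β → 0 < γ → ∀ T : ℝ, 0 < T → ∀ E : ℕ → ℝ, (∀ N : ℕ, E N = 1 - γ / T ^ 2 * ∫ u in Set.Ioi (0 : ℝ), (if h : 0 < N then ∫ z, ((z.2 ⟨0, h⟩) ^ 2 - T) * (∫ y, ((y.2 ⟨0, h⟩) ^ 2 - T) ∂((Literature.MathematicalPhysics.KineticTheory.HeatConduction.pinnedChain ω₂ lam β γ).transitionKernel N T T u.toNNReal z)) ∂((Literature.MathematicalPhysics.KineticTheory.HeatConduction.pinnedChain ω₂ lam β γ).gibbsMeasure N T) else 0)) → ∃ C : ℝ, ∀ n m : ℕ, 2 ≤ n → 2 ≤ m → 1 / (γ * E (n + m)) ≤ 1 / (γ * E n) + 1 / (γ * E m) + C) → Summit.AtomisticToContinuum.FouriersLaw.Theses.OddSectorIrreversibility.BoundedResponseConverges :=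
  fun hQ =>
    Summit.AtomisticToContinuum.FouriersLaw.Cruxes.BoundedResponseConverges.TwoScaleGluingLogRigidity.Stubs.boundedResponseConverges_of_quasiSubadditiveResistance
      (quasiSubadditiveResistance_of_escapeResistanceQuasiSubadditive hQ)

/-- **The E-form series law fills the import slot `BondHeatUncertainty.PositiveOrInfiniteLimit`
(stmt-AtomisticToContinuum-9128):** under weak-NESS uniqueness, along every steady-state family and
`T > 0`, the response coefficients converge in `EReal` to some `ℓ ∈ (0, +∞]` — through
`quasiSubadditiveResistance_of_escapeResistanceQuasiSubadditive` and the landed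
`Stubs.positiveOrInfiniteLimit_of_quasiSubadditiveResistance` (the two route copies of the slot are
definitionally equal). [folklore] -/
theorem positiveOrInfiniteLimit_of_escapeResistanceQuasiSubadditive : (∀ ω₂ lam β γ : ℝ, 0 < ω₂ → 0 < lam → 0 < β → 0 < γ → ∀ T : ℝ, 0 < T → ∀ E : ℕ → ℝ, (∀ N : ℕ, E N = 1 - γ / T ^ 2 * ∫ u in Set.Ioi (0 : ℝ), (if h : 0 < N then ∫ z, ((z.2 ⟨0, h⟩) ^ 2 - T) * (∫ y, ((y.2 ⟨0, h⟩) ^ 2 - T) ∂((Literature.MathematicalPhysics.KineticTheory.HeatConduction.pinnedChain ω₂ lam β γ).transitionKernel N T T u.toNNReal z)) ∂((Literature.MathematicalPhysics.KineticTheory.HeatConduction.pinnedChain ω₂ lam β γ).gibbsMeasure N T) else 0)) → ∃ C : ℝ, ∀ n m : ℕ, 2 ≤ n → 2 ≤ m → 1 / (γ * E (n + m)) ≤ 1 / (γ * E n) + 1 / (γ * E m) + C) → Summit.AtomisticToContinuum.FouriersLaw.Theses.BondHeatUncertainty.PositiveOrInfiniteLimit :=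
  fun hQ =>
    Summit.AtomisticToContinuum.FouriersLaw.Cruxes.BoundedResponseConverges.TwoScaleGluingLogRigidity.Stubs.positiveOrInfiniteLimit_of_quasiSubadditiveResistance
      (quasiSubadditiveResistance_of_escapeResistanceQuasiSubadditive hQ)

/-- **The E-form series law gives the Ohmic floor `JunctionLocality.ConductanceLowerBound`
(stmt-AtomisticToContinuum-11749):** eventually `D N ≥ c > 0` along every steady-state family under
weak-NESS uniqueness — an `EReal` limit `ℓ > 0` (`positiveOrInfiniteLimit_of_escapeResistanceQuasiSubadditive`)
forces a positive eventual lower bound (`PositiveOrInfiniteLimit.conductanceLowerBound_of_positiveOrInfiniteLimit`).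
[folklore] -/
theorem conductanceLowerBound_of_escapeResistanceQuasiSubadditive : (∀ ω₂ lam β γ : ℝ, 0 < ω₂ → 0 < lam → 0 < β → 0 < γ → ∀ T : ℝ, 0 < T → ∀ E : ℕ → ℝ, (∀ N : ℕ, E N = 1 - γ / T ^ 2 * ∫ u in Set.Ioi (0 : ℝ), (if h : 0 < N then ∫ z, ((z.2 ⟨0, h⟩) ^ 2 - T) * (∫ y, ((y.2 ⟨0, h⟩) ^ 2 - T) ∂((Literature.MathematicalPhysics.KineticTheory.HeatConduction.pinnedChain ω₂ lam β γ).transitionKernel N T T u.toNNReal z)) ∂((Literature.MathematicalPhysics.KineticTheory.HeatConduction.pinnedChain ω₂ lam β γ).gibbsMeasure N T) else 0)) → ∃ C : ℝ, ∀ n m : ℕ, 2 ≤ n → 2 ≤ m → 1 / (γ * E (n + m)) ≤ 1 / (γ * E n) + 1 / (γ * E m) + C) → Summit.AtomisticToContinuum.FouriersLaw.Theses.JunctionLocality.ConductanceLowerBound :=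
  fun hQ =>
    Summit.AtomisticToContinuum.FouriersLaw.Theorems.PositiveOrInfiniteLimit.conductanceLowerBound_of_positiveOrInfiniteLimit
      (positiveOrInfiniteLimit_of_escapeResistanceQuasiSubadditive hQ)

end Summit.AtomisticToContinuum.FouriersLaw.Theorems.EscapeDeficitDichotomy

end
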